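import Summits.ValiantsHypothesis.ValiantsHypothesis.Theorems.KPlusLogSqLawValuativeDoorProgressionFree
import Summits.ValiantsHypothesis.ValiantsHypothesis.Theorems.KPlusLogSqLawValuativeDoorFGPlusOne

/-!
# LINE `valuative_door` (crux `WeakLifting`, stmt-ValiantsHypothesis-19561) — `f·g + 1` OBEYS THE SIDON ROW `3K − 4` UNLESS ITS CONSTANT
# TERM CANCELS (the valuative twin of the «easy case» of Koiran–Portier–Tavenas–Thomassé's `Newt(fg + 1)` question)

HONEST FRAMING.  Helper (cell `pub-symmetroid`, seat val-sym-lift-p1 g24, 2026-08-29; `--supports 19561 --as helper`), joining the landed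
dictionary `…ValuativeDoorFGPlusOne` (`det Σ X^{d_l} !![p_l, δ_{l l₀}; δ_{l l₀}, −q_l] = −(f g + 1)`, `f = Σ p_l X^{d_l}`, `g = Σ q_l X^{d_l}`,
`d l₀ = 0`) to the landed progression-free law `…ValuativeDoorProgressionFree` (`valProgressionFree_unfolded`: symmetric width-two pencils whose
progression binomials are cancellation-free have `npEdges ≤ 3K − 4`).  For the `fg + 1` letters every progression binomial
`a_{l₁} c_{l₂} − b_{l₃}²` with `l₃ ≠ l₀` is the single product `−p_{l₁} q_{l₂}` (trivially cancellation-free), and the one with `l₃ = l₀` forces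
`d_{l₁} = d_{l₂} = 0`, i.e. `l₁ = l₂ = l₀` on an injective support, where it reads `−(p_{l₀} q_{l₀} + 1)`: SO THE ONLY POSSIBLE OBSTRUCTION IS
THE CONSTANT TERM OF `f g + 1`.  THEOREM (`valFGPlusOne_sidon_unfolded`, all `K`, every non-archimedean field): if
`v(p_{l₀} q_{l₀} + 1) = max(v(p_{l₀} q_{l₀}), 1)` (the constant term of `f g + 1` does not cancel valuatively) then
`npEdges_v(f g + 1) ≤ 3K − 4` for all `f, g` on the common injective `K`-support `d ∋ 0`.  READING (prose): this is the valuative form of the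
dichotomy in Koiran–Portier–Tavenas–Thomassé (FoCM 2015, Appendix, doi:10.1007/s10208-014-9216-x = arXiv:1308.2286): «if `fg + 1` has a
constant term then `Newt(fg + 1) = Newt(fg)`; the difficult case appears when the constant term of `fg` equals `−1`» — here with NO
convexity condition (ii) on the support and with the Sidon constant `3K − 4` (`K` = size of the common support incl. `0`); the difficult case
is exactly a valuatively SINGULAR LETTER `!![p_{l₀}, 1; 1, −q_{l₀}]` (`det = −(p_{l₀} q_{l₀} + 1) ≈ 0`), the degenerate cancelling progression
`x = y = z = 0` of the progression-free law.  No bound is claimed in the cancelling case (open-problem-hard by the dictionary file).  Nothing here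
is a stub of the line or closes anything; no bearing on vW / vB, `TropicalB`, `MatrixDescartes` (18050) or VP ≠ VNP.  [elementary corollary]
-/

set_option linter.dupNamespace false
set_option autoImplicit false

namespace Summit.ValiantsHypothesis.ValiantsHypothesis.Theorems.KPlusLogSqLaw.ValDoor

open Polynomial Finset
open scoped BigOperators Classical

variable {F : Type*} [Field F]

/-- the progression binomials of the `fg + 1` letters are cancellation-free as soon as the constant term of `f g + 1` does not cancel.
[bookkeeping: off `l₀` the binomial is a single product; at `l₀` it is `−(p_{l₀} q_{l₀} + 1)`] -/
theorem fgLetter_progressionFree (v : AbsoluteValue F ℝ) {K : ℕ} (d : Fin K → ℕ) (hd : Function.Injective d) (l₀ : Fin K) (h0 : d l₀ = 0)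
    (p q : Fin K → F) (hconst : v (p l₀ * q l₀ + 1) = max (v (p l₀ * q l₀)) 1) :
    ∀ l₁ l₂ l₃ : Fin K, d l₁ + d l₂ = d l₃ + d l₃ →
      v ((!![p l₁, if l₁ = l₀ then (1 : F) else 0; if l₁ = l₀ then (1 : F) else 0, -q l₁] : Matrix (Fin 2) (Fin 2) F) 0 0
          * (!![p l₂, if l₂ = l₀ then (1 : F) else 0; if l₂ = l₀ then (1 : F) else 0, -q l₂] : Matrix (Fin 2) (Fin 2) F) 1 1
          - (!![p l₃, if l₃ = l₀ then (1 : F) else 0; if l₃ = l₀ then (1 : F) else 0, -q l₃] : Matrix (Fin 2) (Fin 2) F) 0 1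
          * (!![p l₃, if l₃ = l₀ then (1 : F) else 0; if l₃ = l₀ then (1 : F) else 0, -q l₃] : Matrix (Fin 2) (Fin 2) F) 0 1)
        = max (v ((!![p l₁, if l₁ = l₀ then (1 : F) else 0; if l₁ = l₀ then (1 : F) else 0, -q l₁] : Matrix (Fin 2) (Fin 2) F) 0 0
            * (!![p l₂, if l₂ = l₀ then (1 : F) else 0; if l₂ = l₀ then (1 : F) else 0, -q l₂] : Matrix (Fin 2) (Fin 2) F) 1 1))
          (v ((!![p l₃, if l₃ = l₀ then (1 : F) else 0; if l₃ = l₀ then (1 : F) else 0, -q l₃] : Matrix (Fin 2) (Fin 2) F) 0 1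
            * (!![p l₃, if l₃ = l₀ then (1 : F) else 0; if l₃ = l₀ then (1 : F) else 0, -q l₃] : Matrix (Fin 2) (Fin 2) F) 0 1)) := by
  intro l₁ l₂ l₃ hS
  simp only [Matrix.of_apply, Matrix.cons_val', Matrix.cons_val_zero, Matrix.cons_val_one, Matrix.cons_val_fin_one,
    Matrix.empty_val']
  by_cases h3 : l₃ = l₀
  · -- the letter progression at the constant term: `l₁ = l₂ = l₃ = l₀`
    rw [h3, h0, Nat.add_zero, Nat.add_eq_zero_iff] at hS
    have h1 : l₁ = l₀ := hd (hS.1.trans h0.symm)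
    have h2 : l₂ = l₀ := hd (hS.2.trans h0.symm)
    simp only [h1, h2, h3, if_true, mul_one]
    have e1 : p l₀ * -q l₀ - 1 = -(p l₀ * q l₀ + 1) := by ring
    rw [e1, v.map_neg, hconst, mul_neg, v.map_neg, v.map_one]
  · rw [if_neg h3, mul_zero, sub_zero, v.map_zero]
    exact (max_eq_left (v.nonneg _)).symm

/-- **`f·g + 1` OBEYS THE SIDON ROW UNLESS ITS CONSTANT TERM CANCELS, UNFOLDED** (all `K`, every non-archimedean field): for `f = Σ_l p_l X^{d_l}`,
`g = Σ_l q_l X^{d_l}` on a common injective support with `d l₀ = 0`, if `v(p_{l₀} q_{l₀} + 1) = max(v(p_{l₀} q_{l₀}), 1)` then `f g + 1` has at most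
`3K − 4` Newton edges (raw predicate). [`det_fgPencil` + `valProgressionFree_unfolded` + `dominant_filter_neg`] -/
theorem valFGPlusOne_sidon_unfolded :
    ∀ (F : Type) [Field F] (v : AbsoluteValue F ℝ), IsNonarchimedean v → ∀ (K : ℕ) (d : Fin K → ℕ), Function.Injective d →
      ∀ (l₀ : Fin K), d l₀ = 0 → ∀ (p q : Fin K → F), v (p l₀ * q l₀ + 1) = max (v (p l₀ * q l₀)) 1 →
        (((∑ l, C (p l) * (X : F[X]) ^ d l) * (∑ l, C (q l) * (X : F[X]) ^ d l) + 1).support.filter fun E =>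
            ∃ r : ℝ, 0 < r ∧ ∀ E' ∈ ((∑ l, C (p l) * (X : F[X]) ^ d l) * (∑ l, C (q l) * (X : F[X]) ^ d l) + 1).support, E' ≠ E →
              v (((∑ l, C (p l) * (X : F[X]) ^ d l) * (∑ l, C (q l) * (X : F[X]) ^ d l) + 1).coeff E') * r ^ E'
                < v (((∑ l, C (p l) * (X : F[X]) ^ d l) * (∑ l, C (q l) * (X : F[X]) ^ d l) + 1).coeff E) * r ^ E).card - 1
          ≤ 3 * K - 4 := by
  intro F _ v hv K d hd l₀ h0 p q hconst
  have h := valProgressionFree_unfolded F v hv K d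
    (fun l => !![p l, if l = l₀ then (1 : F) else 0; if l = l₀ then (1 : F) else 0, -q l])
    (fun l => fgLetter_isSymm p q l₀ l) hd (fgLetter_progressionFree v d hd l₀ h0 p q hconst)
  rw [det_fgPencil d l₀ h0 p q, dominant_filter_neg] at h
  exact h

end Summit.ValiantsHypothesis.ValiantsHypothesis.Theorems.KPlusLogSqLaw.ValDoor
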